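import Summits.QuantumFields.GaugeBoot.Certificates.SparseReducedWindow
import Summits.QuantumFields.GaugeBoot.Certificates.KZL2rpD4b11o5Chi3o2LoDA
import Summits.QuantumFields.GaugeBoot.Certificates.KZL2rpD4b11o5Chi3o2LoDB
import HarnessLib

/-!
# Kernel replay of the certsdp certificate `kzL2_D4_b11o5_max_rp_G2-lin-chi22-c3o2-lower-x144` — part G: factor-row assembly and objective (gb_lean_emit_win 0.10.1)

Cell `ym-instrument` (HUMAN RULING D-0084 (2)), seat `ym-instrument-boot-lean-1`: crew (a) certificate row `SU2-D4-b11o5-kzL2rp-lin-chi22-c3o2-lower`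
(`pub/ym-instrument/certs/a/files/SU2-D4/kzL2rp/`, Q-A1 R-A1.0 STEP-0 G0 record row, REF-3 CERT-PASS 2026-08-26T18:27:53Z), emitted with the INHERITED
`pub-gaugeboot` emitter `gb_lean_emit_win 0.10.1` (kit job j258860; family tables `KZL2rpD4*` of record, family signature 981d7f3d61508310).
SCALING (bookkeeping, exact): the row's objective ℓ_{3/2} = W̄(1×2) − (3/4)·W̄(2×2) − (1/3)·ū_P has rational coefficients, while the
inherited emitter requires an integer objective row; the (problem, certificate) pair of record was therefore rescaled by 144 = 12² before emission
(`scale.py`, kit j258860: objective row ×144 = 144·y_2 − 48·y_1 − 108·y_13, equality multipliers ×144, Gram factor rows ×12, claimed bound ×144 =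
144·(−0.4074032425…); eq_rows / labels / psd_blocks UNCHANGED, sha fields re-labelled `x144:<sha of record>`); the emitter's exact bound recomputation
passed on the scaled pair, and the unscaled inequality `−0.4074… ≤ ℓ_{3/2}` is recovered in the bind file `Rows/KZL2rpD4BindB11o5Chi3o2` by dividing by 144.
HONEST FRAMING (cells `pub-gaugeboot` / `ym-instrument`): certified bounds on lattice expectations at stated coupling,
gauge group, dimension and torus size; NOT a mass gap, NOT a continuum limit, NOT a string tension;
NOT Yang–Mills-summit-bearing (barriers `FixedCouplingUltralocality`, `PerturbativeInvisibility`).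

Certificate sha256 `x144(lambda),x12(G):f15402a8f2f37a7f638298d5411d1abce412f8bda1d50969489083bf3ca2bc7a` (problem `kzL2_D4_b11o5_max_rp_G2-lin-chi22-c3o2-lower-x144`, sha256 `x144:30bc2aef839243d110c40ea326116c0089e02ab356218b87c9a743b97fe81f84`): `GB` = all factor rows (data parts
`Certificates/KZL2rpD4b11o5Chi3o2LoD….lean` concatenated), the INTEGER objective row `cZ`, the certified bound `lowerQ`, and the kernel check
`gb_len` (factor rows fit the padded dimension 48). Windows: `Certificates/KZL2rpD4b11o5Chi3o2LoA….lean`; assembly + theorems: `Certificates/KZL2rpD4b11o5Chi3o2Lo.lean`.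
Data/plumbing only; nothing is claimed about lattice gauge theory in this file.
-/

namespace Summit.QuantumFields.GaugeBoot.Certificates.KZL2rpD4b11o5Chi3o2Lo

noncomputable section

open Summit.QuantumFields.GaugeBoot.Certificates.Sparse

/-- All factor rows (concatenation of the data parts' block lists). -/
def GB : List (List (List ℤ)) := GBa ++ GBb

/-- Objective as a sparse INTEGER row: (-48)·y_1 + (144)·y_2 + (-108)·y_13. -/
def cZ : List (ℕ × ℤ) := [(1, Int.negSucc 47), (2, 144), (13, Int.negSucc 107)]

/-- The certified lower bound on the objective (exact): `-608427255486957989732456456643083/10371025151354171336058470400000` (≈ -58.6660669131165). -/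
def lowerQ : ℚ := -608427255486957989732456456643083/10371025151354171336058470400000

set_option maxHeartbeats 0 in
/-- Kernel check: every factor row of every block has length `≤ 48`. -/
theorem gb_len : lenCheckAll KZL2rpD4b11o5Chi3o2Lo.GB 48 70 = true := by
  decide +kernel

end

end Summit.QuantumFields.GaugeBoot.Certificates.KZL2rpD4b11o5Chi3o2Lo
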